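import Literature.MathematicalPhysics.QuantumFieldTheory.ConformalBootstrap3D.PointKernelK34L515.Cert

/-!
# K34L515 instance, cell `l6c11` (parts file: groups 0:32)

Kernel-v3 cell of the point-functional exclusion instance for the lower box `Δσ ∈ [0.515, 0.520]`,
`Δε ∈ [0.6, 0.95)` (certificate `certL515`, module `PointKernelK34L515.Cert`): spin `ℓ = 6`,
`Δ ∈ [249/32, 253/32)` (centre `A`, half-width `2^-4`), Taylor degree `4`, `n_F = 40`, `1` s-piece(s)
covering `s = Δσ ∈ [103/200, 13/25]`.  Group theorems `l6c11_part<i>_<a>_<b> : gPart … = some <literal>` are checked by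
`decide +kernel` (the literals were produced by `#eval` of the same function); the cell numbers `l6c11_num<i> ≥ 0`
likewise; `l6c11_block` is `PKTM.blockPositive_of_cellPass` applied to them. This file holds only group theorems (the cell stated as a literal); the final file of the cell imports it.  Generated by
`gen/mk_v3cell.py` / `gen/drive_v3.py` (typer-g8).  [folklore]
-/

set_option Elab.async false

namespace Literature.MathematicalPhysics.QuantumFieldTheory.ConformalBootstrap3D

namespace PointKernelK34L515

open PointKernel PKTM
open Literature.Analysis.ValidatedNumerics.PolyMP
open Literature.Analysis.ValidatedNumerics.NumericsMP

/-- group model literal [folklore] -/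
def l6c11_g0_32_34 : G3 := ([⟨578081053364731755198491117241295345801, 578081053980918618419533719596708423238⟩, ⟨58157058375285465815096521381762931553, 58157059323977391166539646942405565035⟩, ⟨688182832047752291305252739824613307, 688183946987645255642843063349995008⟩, ⟨1023183744904717388246966934528467049, 1023184818460822308377980259312730043⟩, ⟨-486786983678464887138541371255498105, -486786095807910026898867573267571971⟩], [⟨-6966560687651548968149114820575339673, -6966560680286946774191689374952882716⟩, ⟨-697462451057796572430302631870532223, -697462439627693758416500055831339861⟩, ⟨-10247115203750205746745806307558835, -10247101769387254545021247568689756⟩, ⟨-11722503346749989911957663142631352, -11722490409691060961107029296633285⟩, ⟨5707230617022106554991417992719714, 5707241317716514292169170205324651⟩], [⟨42469560842809255588389506420922110, 42469560887608602181627074112177379⟩, ⟨4248469687874843684909698169765500, 4248469757574302234030080467455065⟩, ⟨67366085815204675198222425488346, 67366167743755343167522403645805⟩, ⟨70278075278898962109709596834425, 70278154185175016512752938928478⟩, ⟨-34450473226786180175058699557464, -34450407950403552765736244512404⟩])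

/-- group `[32, 34)` of piece 0 [folklore] -/
theorem l6c11_part0_32_34 : gPart certL515 (⟨6, ((251 : ℚ) / 32), 4, 4, 40, 6, 64, ⟨3, 0, 5, 118, 0, 0⟩⟩ : TMCell) (pc ps1 0) 32 34 = some l6c11_g0_32_34 := by decide +kernel

end PointKernelK34L515

end Literature.MathematicalPhysics.QuantumFieldTheory.ConformalBootstrap3D
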